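import Summits.Parity.GeneralizedHardyLittlewood.Theorems.PrimeLevelFamEdgeIdeaDeltasNegationRogueKill
import HarnessLib

/-!
# Route `PrimeLevelFamEdge` — TYPED IDEA DELTAS, deck 14g: K-L20-3 «THE ROGUE FORM», part 4 — PRESERVATION: the rogue
# extension keeps the transported constraints of record (`massFam_rogue`, `peterssonBoundFam_rogue` via `ψ² ≤ 9m/8`,
# `bettinFam_rogue`, `nonnegFam_rogue`, `floor_rogue`) (§6) and the size bookkeeping of the rogue's own display terms
# (`coeffBound`, `abs_rogueMollSum_le`) (§6b, first half).  Seat ls-idea-lens-20 gen 2, `Sketch_L20c_RogueForm.lean` v10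
# sha16 64d60d2997a1fa36 l.818–1070 VERBATIM up to the namespace relabel (typer ls-idea-typ-1 gen 3); critic E b8 PASS.
HONESTY: everything here is about TABLES (axiomatised families), which cannot instantiate `KMV2000.MomentAsymptotics`
(REF-E (E5)); nothing proves K_A (stmt-Parity-20007), K_B, any moment asymptotic or any exceptional-zero theorem (no
Landau–Siegel / Siegel-zero exclusion, no Theorem 1–2 of arXiv:2211.02515, no repaired Margin232); typed ≠ proved.
-/

noncomputable section

open scoped Real
open Finset Complex Polynomial CongruenceSubgroup
open Literature.NumberTheory.LFunctions
open Literature.NumberTheory.LFunctions.KMV2000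
open Literature.NumberTheory.EllipticCurves.ModularForms

namespace Summit.Parity.GeneralizedHardyLittlewood.Theorems.PrimeLevelFamEdgeIdeaDeltas.Negation

universe u

variable {α : Type u}
variable {β : ℕ → Type u}

/-! ## §6. PRESERVATION: the rogue extension keeps the transported constraints of record -/

/-- `ψ(m)² ≤ (9/8)·m` (`(1+1/p)² ≤ p` for `p ≥ 3`, `(1+1/2)² = (9/8)·2`; `∏_{p ∣ m} p ≤ m`). -/
theorem psi_sq_le (m : ℕ) (hm : 1 ≤ m) : psi m ^ 2 ≤ 9 / 8 * m := by
  classical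
  unfold psi
  rw [← Finset.prod_pow]
  have hrad : (∏ p ∈ m.primeFactors, (p : ℝ)) ≤ m := by
    have h := Nat.le_of_dvd (by omega) (Nat.prod_primeFactors_dvd m)
    rw [← Nat.cast_prod]
    exact_mod_cast h
  have hfac : ∀ p ∈ m.primeFactors, (1 + (p : ℝ)⁻¹) ^ 2 = ((1 + (p : ℝ)⁻¹) ^ 2 / p) * p := by
    intro p hp
    have hp0 : (0 : ℝ) < p := by exact_mod_cast (Nat.prime_of_mem_primeFactors hp).pos
    field_simp
  rw [Finset.prod_congr rfl hfac, Finset.prod_mul_distrib]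
  have hnonneg : ∀ p ∈ m.primeFactors, 0 ≤ (1 + (p : ℝ)⁻¹) ^ 2 / p := fun p _ ↦ by positivity
  have hle1 : ∀ p ∈ m.primeFactors, p ≠ 2 → (1 + (p : ℝ)⁻¹) ^ 2 / p ≤ 1 := by
    intro p hp hp2
    have hpp := Nat.prime_of_mem_primeFactors hp
    have hp3 : (3 : ℝ) ≤ p := by
      have := hpp.two_le
      exact_mod_cast (by omega : 3 ≤ p)
    have hp0 : (0 : ℝ) < p := by linarith
    rw [div_le_one hp0]
    have hinv : (p : ℝ)⁻¹ ≤ 3⁻¹ := inv_anti₀ (by norm_num) hp3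
    have h1 : 1 + (p : ℝ)⁻¹ ≤ 4 / 3 := by linarith
    have h2 : (1 + (p : ℝ)⁻¹) ^ 2 ≤ (4 / 3) ^ 2 := pow_le_pow_left₀ (by positivity) h1 2
    linarith
  have hg : ∏ p ∈ m.primeFactors, (1 + (p : ℝ)⁻¹) ^ 2 / p ≤ 9 / 8 := by
    by_cases h2 : 2 ∈ m.primeFactors
    · rw [← Finset.mul_prod_erase _ _ h2]
      have hrest : ∏ p ∈ m.primeFactors.erase 2, (1 + (p : ℝ)⁻¹) ^ 2 / p ≤ 1 :=
        Finset.prod_le_one (fun p hp ↦ hnonneg p (Finset.mem_of_mem_erase hp))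
          (fun p hp ↦ hle1 p (Finset.mem_of_mem_erase hp) (Finset.ne_of_mem_erase hp))
      have hrest0 : 0 ≤ ∏ p ∈ m.primeFactors.erase 2, (1 + (p : ℝ)⁻¹) ^ 2 / p :=
        Finset.prod_nonneg fun p hp ↦ hnonneg p (Finset.mem_of_mem_erase hp)
      have h98 : (1 + ((2 : ℕ) : ℝ)⁻¹) ^ 2 / ((2 : ℕ) : ℝ) = 9 / 8 := by norm_num
      rw [h98]
      nlinarith
    · refine (Finset.prod_le_one hnonneg fun p hp ↦ hle1 p hp ?_).trans (by norm_num)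
      rintro rfl
      exact h2 hp
  have hg0 : 0 ≤ ∏ p ∈ m.primeFactors, (1 + (p : ℝ)⁻¹) ^ 2 / p := Finset.prod_nonneg hnonneg
  have hrad0 : 0 ≤ ∏ p ∈ m.primeFactors, (p : ℝ) := Finset.prod_nonneg fun p _ ↦ Nat.cast_nonneg p
  calc (∏ p ∈ m.primeFactors, (1 + (p : ℝ)⁻¹) ^ 2 / p) * ∏ p ∈ m.primeFactors, (p : ℝ)
      ≤ 9 / 8 * m := mul_le_mul hg hrad hrad0 (by norm_num)

/-- `ψ(m) ≤ (3/2)·√m`. -/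
theorem psi_le_sqrt (m : ℕ) (hm : 1 ≤ m) : psi m ≤ 3 / 2 * Real.sqrt m := by
  have h0 : 0 ≤ psi m := le_trans zero_le_one (one_le_psi m)
  have h1 : psi m ^ 2 ≤ (3 / 2 * Real.sqrt m) ^ 2 := by
    rw [mul_pow, Real.sq_sqrt (Nat.cast_nonneg m)]
    have := psi_sq_le m hm
    nlinarith
  nlinarith [sq_nonneg (psi m - 3 / 2 * Real.sqrt m), sq_nonneg (psi m + 3 / 2 * Real.sqrt m),
    Real.sqrt_nonneg (m : ℝ)]

/-- `|λ*(m)| ≤ ψ(m) ≤ (3/2)√m` (Deligne-compatible: on squarefree `m`, `ψ(m) ≤ 2^{ω(m)} = d(m)`). -/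
theorem norm_rogueLam_le (m : ℕ) (hm : 1 ≤ m) : ‖rogueLam m‖ ≤ 3 / 2 * Real.sqrt m := by
  unfold rogueLam
  rw [Complex.norm_real, Real.norm_eq_abs, abs_mul, abs_of_nonneg (le_trans zero_le_one (one_le_psi m))]
  have hμ : |(ArithmeticFunction.moebius m : ℝ)| ≤ 1 := by
    have h := ArithmeticFunction.abs_moebius_le_one (n := m)
    exact_mod_cast h
  calc |(ArithmeticFunction.moebius m : ℝ)| * psi m ≤ 1 * psi m :=
        mul_le_mul_of_nonneg_right hμ (le_trans zero_le_one (one_le_psi m))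
    _ ≤ 3 / 2 * Real.sqrt m := by rw [one_mul]; exact psi_le_sqrt m hm

/-- PRESERVED: the transported harmonic mass `kmv2000_eq4` (new constant `C + 1`). -/
theorem massFam_rogue (𝓕 : Tables β) (h : MassFam 𝓕) : MassFam (rogueTables 𝓕) := by
  obtain ⟨C, hC⟩ := h
  refine ⟨C + 1, fun q _ hq ↦ ?_⟩
  rw [rogueTables_apply, rogue_mass]
  have h1 := hC q hq
  have hw : 0 ≤ rogueW q := by unfold rogueW; positivity
  calc |rogueW q + (𝓕 q).mass - 1| = |((𝓕 q).mass - 1) + rogueW q| := by ring_nf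
    _ ≤ |(𝓕 q).mass - 1| + |rogueW q| := abs_add_le _ _
    _ ≤ C * (q : ℝ) ^ (-(3 / 2 : ℝ)) + (q : ℝ) ^ (-(3 / 2 : ℝ)) := by
        rw [abs_of_nonneg hw]; unfold rogueW; linarith
    _ = (C + 1) * (q : ℝ) ^ (-(3 / 2 : ℝ)) := by ring

/-- PRESERVED: the transported Kowalski–Michel Petersson BOUND (new constant `C + 9/4`):
the rogue pair term is `q^{-3/2} λ*(m) λ*(n)` with `|λ*(m)λ*(n)| ≤ (9/4)(mn)^{1/2}`. -/
theorem peterssonBoundFam_rogue (𝓕 : Tables β) (h : PeterssonBoundFam 𝓕) :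
    PeterssonBoundFam (rogueTables 𝓕) := by
  intro ε hε
  obtain ⟨C, hC⟩ := h ε hε
  refine ⟨C + 9 / 4, fun q _ hq m n hm hn hmn ↦ ?_⟩
  rw [rogueTables_apply, petF_rogue]
  have h1 := hC q hq m n hm hn hmn
  have hw : 0 ≤ rogueW q := by unfold rogueW; positivity
  have hmn1 : (1 : ℝ) ≤ (m : ℝ) * n := by
    have : (1 : ℝ) ≤ m := by exact_mod_cast hm
    have : (1 : ℝ) ≤ n := by exact_mod_cast hn
    nlinarith
  have hlam : ‖rogueLam m * rogueLam n‖ ≤ 9 / 4 * ((m : ℝ) * n) ^ (1 / 2 + ε) := by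
    rw [norm_mul]
    have hm' := norm_rogueLam_le m hm
    have hn' := norm_rogueLam_le n hn
    have hsqrt : Real.sqrt m * Real.sqrt n ≤ ((m : ℝ) * n) ^ (1 / 2 + ε) := by
      rw [← Real.sqrt_mul (Nat.cast_nonneg m), Real.sqrt_eq_rpow]
      exact Real.rpow_le_rpow_of_exponent_le hmn1 (by linarith)
    calc ‖rogueLam m‖ * ‖rogueLam n‖ ≤ (3 / 2 * Real.sqrt m) * (3 / 2 * Real.sqrt n) :=
          mul_le_mul hm' hn' (norm_nonneg _) (by positivity)
      _ = 9 / 4 * (Real.sqrt m * Real.sqrt n) := by ring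
      _ ≤ 9 / 4 * ((m : ℝ) * n) ^ (1 / 2 + ε) := by gcongr
  calc ‖(rogueW q : ℂ) * (rogueLam m * rogueLam n) + petF (𝓕 q) m n - (if m = n then 1 else 0)‖
      = ‖(petF (𝓕 q) m n - (if m = n then 1 else 0)) + (rogueW q : ℂ) * (rogueLam m * rogueLam n)‖ := by
        ring_nf
    _ ≤ ‖petF (𝓕 q) m n - (if m = n then 1 else 0)‖ + ‖(rogueW q : ℂ) * (rogueLam m * rogueLam n)‖ :=
        norm_add_le _ _
    _ ≤ C * (((m : ℝ) * n) ^ (1 / 2 + ε)) * (q : ℝ) ^ (-(3 / 2 : ℝ)) +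
          rogueW q * (9 / 4 * ((m : ℝ) * n) ^ (1 / 2 + ε)) := by
        gcongr
        rw [norm_mul, Complex.norm_real, Real.norm_eq_abs, abs_of_nonneg hw]
        exact mul_le_mul_of_nonneg_left hlam hw
    _ = (C + 9 / 4) * (((m : ℝ) * n) ^ (1 / 2 + ε)) * (q : ℝ) ^ (-(3 / 2 : ℝ)) := by
        unfold rogueW; ring

/-- PRESERVED: the transported Bettin first moment (`T₁ = 0` beyond the diagonal; new constant
`C + 3/2`): the rogue term is `q^{-3/2} · μψ(m) · √q = O(m^{1/2} q^{-1})`. -/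
theorem bettinFam_rogue (𝓕 : Tables β) (h : BettinFam 𝓕) : BettinFam (rogueTables 𝓕) := by
  intro ε hε
  obtain ⟨C, N₀, hC⟩ := h ε hε
  refine ⟨C + 3 / 2, N₀, fun N _ hN hN₀ m hm ↦ ?_⟩
  rw [rogueTables_apply, twistedFirstF_rogue]
  have h1 := hC N hN hN₀ m hm
  have hNpos : (0 : ℝ) < N := by exact_mod_cast hN.pos
  have hN1 : (1 : ℝ) ≤ N := by exact_mod_cast hN.one_le
  have hw : 0 ≤ rogueW N := by unfold rogueW; positivity
  have hrogue : ‖(rogueW N : ℂ) * (rogueLam m * ((Real.sqrt N : ℝ) : ℂ))‖ ≤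
      3 / 2 * (m : ℝ) ^ (1 / 2 : ℝ) * (N : ℝ) ^ (-1 + ε) := by
    rw [norm_mul, norm_mul, Complex.norm_real, Complex.norm_real, Real.norm_eq_abs,
      Real.norm_eq_abs, abs_of_nonneg hw, abs_of_nonneg (Real.sqrt_nonneg _)]
    have hlam := norm_rogueLam_le m hm
    have hpow : rogueW N * Real.sqrt N = (N : ℝ) ^ (-1 : ℝ) := by
      unfold rogueW
      rw [Real.sqrt_eq_rpow, ← Real.rpow_add hNpos]
      norm_num
    have hpow' : (N : ℝ) ^ (-1 : ℝ) ≤ (N : ℝ) ^ (-1 + ε) :=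
      Real.rpow_le_rpow_of_exponent_le hN1 (by linarith)
    calc rogueW N * (‖rogueLam m‖ * Real.sqrt N) = ‖rogueLam m‖ * (rogueW N * Real.sqrt N) := by ring
      _ ≤ (3 / 2 * Real.sqrt m) * (N : ℝ) ^ (-1 + ε) := by
          rw [hpow]
          exact mul_le_mul hlam hpow' (by positivity) (by positivity)
      _ = 3 / 2 * (m : ℝ) ^ (1 / 2 : ℝ) * (N : ℝ) ^ (-1 + ε) := by rw [Real.sqrt_eq_rpow]
  calc ‖(rogueW N : ℂ) * (rogueLam m * ((Real.sqrt N : ℝ) : ℂ)) + twistedFirstF N (𝓕 N) m -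
        (((m : ℝ) ^ (-(1 / 2 : ℝ)) : ℝ) : ℂ)‖
      = ‖(twistedFirstF N (𝓕 N) m - (((m : ℝ) ^ (-(1 / 2 : ℝ)) : ℝ) : ℂ)) +
          (rogueW N : ℂ) * (rogueLam m * ((Real.sqrt N : ℝ) : ℂ))‖ := by ring_nf
    _ ≤ ‖twistedFirstF N (𝓕 N) m - (((m : ℝ) ^ (-(1 / 2 : ℝ)) : ℝ) : ℂ)‖ +
          ‖(rogueW N : ℂ) * (rogueLam m * ((Real.sqrt N : ℝ) : ℂ))‖ := norm_add_le _ _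
    _ ≤ C * (m : ℝ) ^ (1 / 2 : ℝ) * (N : ℝ) ^ (-1 + ε) +
          3 / 2 * (m : ℝ) ^ (1 / 2 : ℝ) * (N : ℝ) ^ (-1 + ε) := add_le_add h1 hrogue
    _ = (C + 3 / 2) * (m : ℝ) ^ (1 / 2 : ℝ) * (N : ℝ) ^ (-1 + ε) := by ring

/-- PRESERVED: non-negative weights. -/
theorem nonnegFam_rogue (𝓕 : Tables β) (h : NonnegFam 𝓕) : NonnegFam (rogueTables 𝓕) :=
  fun q _ ↦ rogue_nonnegWeights q (𝓕 q) (h q)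

/-- PRESERVED: every FLOOR on `Re Q^h` (the shape of `re_QhPQ_one_floor`, the (O0)/(O−) inputs):
a lower bound for `Re Q^h(T)` is a lower bound for `Re Q^h(rogue T)`. -/
theorem floor_rogue (𝓕 : Tables β) (F : ∀ (q : ℕ) [NeZero q], ℝ[X] → ℝ[X] → ℝ → ℝ)
    (h : ∀ (q : ℕ) [NeZero q] (P Q : ℝ[X]) (M : ℝ), F q P Q M ≤ (QhF q (𝓕 q) P Q M).re) :
    ∀ (q : ℕ) [NeZero q] (P Q : ℝ[X]) (M : ℝ), F q P Q M ≤ (QhF q (rogueTables 𝓕 q) P Q M).re :=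
  fun q _ P Q M ↦ (h q P Q M).trans (re_QhF_le_rogue q (𝓕 q) P Q M)

/-! ### §6b. PRESERVED: KMV's diagonal-only law below the diagonal (`Δhi < 1`)

The rogue's own display terms are `a₀ q^{-1} √q̂ S_P(M)` and `a₀² S_P(M)²/(2π)` with
`|S_P(M)| ≤ 2 B_P √M = 2 B_P q̂^{Δ/2}`: inside the tolerances `√q̂/log²`, `q̂/log³` iff `Δ < 1`.
So the countermodel is INVISIBLE to every display of record below the diagonal: the threshold of
§5 is EXACTLY `Δ' = 1`. -/

/-- `B_P = Σ_i |a_i|`, a bound for `|P|` on `[-1, 1]`. -/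
def coeffBound (P : ℝ[X]) : ℝ := ∑ i ∈ range (P.natDegree + 1), |P.coeff i|

/-- The coefficient bound is non-negative. -/
theorem coeffBound_nonneg (P : ℝ[X]) : 0 ≤ coeffBound P :=
  Finset.sum_nonneg fun _ _ ↦ abs_nonneg _

/-- `|P(r)| ≤ coeffBound P` for `|r| ≤ 1`. -/
theorem abs_eval_le_coeffBound (P : ℝ[X]) {r : ℝ} (hr : |r| ≤ 1) : |P.eval r| ≤ coeffBound P := by
  rw [Polynomial.eval_eq_sum_range]
  refine (Finset.abs_sum_le_sum_abs _ _).trans (Finset.sum_le_sum fun i _ ↦ ?_)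
  rw [abs_mul, abs_pow]
  exact mul_le_of_le_one_right (abs_nonneg _) (pow_le_one₀ (abs_nonneg r) hr)

/-- `Σ_{m ≤ N} m^{-1/2} ≤ 2√N`. -/
theorem sum_Icc_rpow_neg_half_le (N : ℕ) :
    ∑ m ∈ Icc 1 N, (m : ℝ) ^ (-(1 / 2 : ℝ)) ≤ 2 * Real.sqrt N := by
  induction N with
  | zero => simp
  | succ N ih =>
    rw [Finset.sum_Icc_succ_top (by omega), Nat.cast_succ]
    have hN1 : (0 : ℝ) < (N : ℝ) + 1 := by positivity
    have hb : 0 < Real.sqrt ((N : ℝ) + 1) := Real.sqrt_pos.mpr hN1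
    have hpow : ((N : ℝ) + 1) ^ (-(1 / 2 : ℝ)) = (Real.sqrt ((N : ℝ) + 1))⁻¹ := by
      rw [Real.sqrt_eq_rpow, Real.rpow_neg hN1.le]
    rw [hpow]
    have ha2 : Real.sqrt (N : ℝ) ^ 2 = N := Real.sq_sqrt (Nat.cast_nonneg N)
    have hb2 : Real.sqrt ((N : ℝ) + 1) ^ 2 = N + 1 := Real.sq_sqrt hN1.le
    have key : 2 * Real.sqrt N + (Real.sqrt ((N : ℝ) + 1))⁻¹ ≤ 2 * Real.sqrt ((N : ℝ) + 1) := by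
      rw [← sub_nonneg]
      have : 2 * Real.sqrt ((N : ℝ) + 1) - (2 * Real.sqrt N + (Real.sqrt ((N : ℝ) + 1))⁻¹) =
          (2 * Real.sqrt ((N : ℝ) + 1) ^ 2 - 2 * Real.sqrt N * Real.sqrt ((N : ℝ) + 1) - 1) /
            Real.sqrt ((N : ℝ) + 1) := by
        field_simp
        ring
      rw [this]
      apply div_nonneg _ hb.le
      nlinarith [sq_nonneg (Real.sqrt ((N : ℝ) + 1) - Real.sqrt N), Real.sqrt_nonneg (N : ℝ)]
    linarith

/-- `|S_P(M)| ≤ 2 B_P √M`. -/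
theorem abs_rogueMollSum_le (P : ℝ[X]) {M : ℝ} (hM : 0 ≤ M) :
    |rogueMollSum P M| ≤ coeffBound P * (2 * Real.sqrt M) := by
  unfold rogueMollSum
  refine (Finset.abs_sum_le_sum_abs _ _).trans ?_
  have hterm : ∀ m ∈ Icc 1 ⌊M⌋₊, |(ArithmeticFunction.moebius m : ℝ) ^ 2 *
      ((m : ℝ) ^ (-(1 / 2 : ℝ)) * P.eval (Real.log (M / m) / Real.log M))| ≤
      coeffBound P * (m : ℝ) ^ (-(1 / 2 : ℝ)) := by
    intro m hm
    rw [Finset.mem_Icc] at hm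
    have hm0 : (0 : ℝ) < m := by exact_mod_cast hm.1
    have hm1 : (1 : ℝ) ≤ m := by exact_mod_cast hm.1
    have hmM : (m : ℝ) ≤ M := (Nat.cast_le.mpr hm.2).trans (Nat.floor_le hM)
    rw [abs_mul, abs_mul, abs_of_nonneg (Real.rpow_nonneg hm0.le _)]
    have hμ : |(ArithmeticFunction.moebius m : ℝ) ^ 2| ≤ 1 := by
      rw [abs_pow]
      have h := ArithmeticFunction.abs_moebius_le_one (n := m)
      have h' : |(ArithmeticFunction.moebius m : ℝ)| ≤ 1 := by exact_mod_cast h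
      exact pow_le_one₀ (abs_nonneg _) h'
    have hr : |Real.log (M / m) / Real.log M| ≤ 1 := by
      rw [abs_div]
      apply div_le_one_of_le₀ _ (abs_nonneg _)
      have h1 : 0 ≤ Real.log (M / m) := Real.log_nonneg ((one_le_div hm0).mpr hmM)
      have h2 : Real.log (M / m) ≤ Real.log M := by
        rw [Real.log_div (by linarith) hm0.ne']
        linarith [Real.log_nonneg hm1]
      rw [abs_of_nonneg h1, abs_of_nonneg (h1.trans h2)]
      exact h2
    have hP := abs_eval_le_coeffBound P hr
    calc |(ArithmeticFunction.moebius m : ℝ) ^ 2| *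
          ((m : ℝ) ^ (-(1 / 2 : ℝ)) * |P.eval (Real.log (M / m) / Real.log M)|)
        ≤ 1 * ((m : ℝ) ^ (-(1 / 2 : ℝ)) * coeffBound P) := by
          apply mul_le_mul hμ _ (by positivity) zero_le_one
          exact mul_le_mul_of_nonneg_left hP (Real.rpow_nonneg hm0.le _)
      _ = coeffBound P * (m : ℝ) ^ (-(1 / 2 : ℝ)) := by ring
  refine (Finset.sum_le_sum hterm).trans ?_
  rw [← Finset.mul_sum]
  refine mul_le_mul_of_nonneg_left ((sum_Icc_rpow_neg_half_le ⌊M⌋₊).trans ?_) (coeffBound_nonneg P)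
  have : Real.sqrt (⌊M⌋₊ : ℝ) ≤ Real.sqrt M := Real.sqrt_le_sqrt (Nat.floor_le hM)
  linarith

end Summit.Parity.GeneralizedHardyLittlewood.Theorems.PrimeLevelFamEdgeIdeaDeltas.Negation

end
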